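import Literature.Algebra.Homology.ContCohomologyPullbackCoboundary
import Literature.AnabelianGeometry.AbsoluteAnabelian.AbsTopIII.CcnTransgressionInjective
import Literature.AnabelianGeometry.AbsoluteAnabelian.AbsTopIII.CcnSynchronizationBijective
import HarnessLib

/-!
# [AbsTopIII] Prop. 1.4 (ii): the differential is SURJECTIVE when `H²(Δ_{U_x}, Λ) = 0`

Mochizuki, *Topics in Absolute Anabelian Geometry III*, §1, Prop. 1.4 (ii), manuscript pp. 31–32 (lit
key `paper:url-5493eb38cbb7`).  abc-iut-L4-t1's NAMED FACT `CurveModel.Prop_1_4_ii_transgression M`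
(FACT-LIST F-0338): for every cyclotome presentation `(U_x ⊆ X, x)` and every continuous section `s`,
the differential `d_s : Hom_cont(Ker(Δ^{c-cn}_{U_x} ↠ Δ_X), Λ) → H²(Δ_X, Λ)` (`ccnTransgression`,
`Λ = Ẑ`) is bijective.  `CcnTransgressionInjective.lean` proves the injectivity half at the instance
class `I_x ≤ [Δ_{U_x}, Δ_{U_x}]⁻`.  This proof-only file (no definitions) proves the SURJECTIVITY half
at the instance class **`H²(Δ_{U_x}, Λ) = 0`** — the cohomological form of "`Δ_U` is a free profinite
group for AFFINE `U`" ([AbsTopI] Lem. 4.5 (i); `cd ≤ 1`), via the five-term exact sequence of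
`1 → N → Δ_{U_x} → Δ_X → 1` at `H²(Δ_X, Λ)` [cite: SerreGaloisCohomology1997, I §2.6 (b)]:

a class `ξ = [F] ∈ H²(Δ_X, Λ)` inflates to `0` in `H²(Δ_{U_x}, Λ)`, i.e. `F ∘ q = d¹σ`; the
continuous function `g := σ(1, ·)` on `Δ_{U_x}` satisfies `g(ye) = g(y) + g(e) − F(1, q y, q(ye))`,
restricts on `N = Ker(Δ_{U_x} ↠ Δ_X)` to a conjugation-invariant continuous homomorphism
`χ = g − F(1,1,1)`, which kills `[N, Δ_{U_x}]⁻` and so descends to `Ker(Δ^{c-cn}_{U_x} ↠ Δ_X)`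
(through `I_x ⥲ Ker`, `inertiaToExtKer_bijective`); and with a continuous section `t₀` of
`Δ_{U_x} ↠ Δ_X` (closed subgroups of profinite groups have continuous cross-sections), `h := g ∘ t₀`
exhibits `F = d¹(h) − χ ∘ c_{t₀}` on cochains, i.e. `ξ = d_s(−χ)`.

(generic ingredients `ContinuousCohomology.homologyπ_two_surjective`, `exists_oneCochain_of_pullback_eq_zero`
in `Literature/Algebra/Homology/ContCohomologyPullbackCoboundary.lean`)

* `ccnTransgression_surjective_of_geomH2_trivial` — for `q : Π_{U_x} → Π_X` mapping `Δ_{U_x}` onto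
  `Δ_X`, a cuspidally central extension datum `IsCuspidallyCentralExtension q I` with `I` closed, and
  `T₁` coefficients `Λ` with `H²(Δ_{U_x}, Λ) = 0`, EVERY `d_s` is surjective;
* `CurveModel.ccnTransgression_surjective_of_subsingleton_geomH2` — the model-level form for cyclotome
  presentations; `CurveModel.ccnTransgression_bijective_of_inertia_le_commutator_of_subsingleton_geomH2`
  and `CurveModel.prop_1_4_ii_transgression_of_instanceClass` — **Prop. 1.4 (ii)'s bijectivity, i.e.
  the named fact `Prop_1_4_ii_transgression M` itself, for every model all of whose cyclotome
  presentations have `Δ_{U_x} ↠ Δ_X`, `I_x ≤ [Δ_{U_x}, Δ_{U_x}]⁻` and `H²(Δ_{U_x}, Ẑ) = 0`** — the named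
  fact DISCHARGED at the printed instance class modulo these transparent structural inputs on the model
  (kept BY NAME).

HONEST FRAMING: refereed pre-IUT material plus generic homological algebra; the inputs (`Δ_U` free for
affine `U`, `Δ_{U_x}^{ab} = Δ_X^{ab}`) are what the geometry of a once-punctured proper curve supplies
in print; nothing here bears on [IUTchIII] Cor. 3.12; typed ≠ proved.
-/

noncomputable section

open CategoryTheory CategoryTheory.Limits TopRep ContRepresentation Topology

/-! ### [AbsTopIII] Prop. 1.4 (ii): surjectivity of the differential from `H²(Δ_{U_x}, Λ) = 0` -/

namespace Literature.AnabelianGeometry.AbsoluteAnabelian.AbsTopIII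

universe u

variable {E F : FundamentalExtension.{u}} (q : E ⟶ F)
variable (Λ : Type u) [AddCommGroup Λ] [TopologicalSpace Λ] [IsTopologicalAddGroup Λ]

/-- **Surjectivity of the differential of Prop. 1.4 (ii) from `H²(Δ_{U_x}, Λ) = 0`.**  Let
`q : Π_{U_x} → Π_X` map `Δ_{U_x}` onto `Δ_X`, let `I ⊆ Π_{U_x}` be closed with
`IsCuspidallyCentralExtension q I` (`1 → I → Δ^{c-cn}_{U_x} → Δ_X → 1` exact), and let `Λ` be a `T₁`
coefficient group with `H²(Δ_{U_x}, Λ) = 0` (every class of Mathlib's `continuousCohomology 2` of the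
trivial `Δ_{U_x}`-module `Λ` vanishes).  Then for every continuous section `s` the differential
`d_s : Hom_cont(Ker(Δ^{c-cn}_{U_x} ↠ Δ_X), Λ) → H²(Δ_X, Λ)` is SURJECTIVE (five-term exactness at
`H²(Δ_X, Λ)`; see the module docstring for the construction `ξ = d_s(−χ)`).
[cite: MochizukiAbsTopIII2015, Prop 1.4 (ii) p.31] -/
theorem ccnTransgression_surjective_of_geomH2_trivial [T1Space Λ]
    (hq : Set.SurjOn q.arith E.geom F.geom) {I : Subgroup E.arith}
    (hI : IsCuspidallyCentralExtension q I) (hIc : IsClosed (I : Set E.arith))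
    (hH2 : ∀ z' : (homogeneousCochains (ContinuousCohomology.trivCoeff E.geom Λ)).cycles 2,
      ((homogeneousCochains (ContinuousCohomology.trivCoeff E.geom Λ)).homologyπ 2).hom z' = 0)
    (s : CcnSection q) : Function.Surjective (ccnTransgression q Λ s) := by
  classical
  -- Topological preliminaries
  haveI : CompactSpace E.arith := inferInstance
  haveI : CompactSpace E.geom := isCompact_iff_compactSpace.mp E.isClosed_geom.isCompact
  haveI : IsClosed (cuspidallyCentralModulus q : Set E.arith) := Subgroup.isClosed_topologicalClosure _
  -- (1) a continuous section `t₀ : Δ_X → Δ_{U_x}` of `q`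
  have hclosed : IsClosed (geomKer q : Set E.geom) := by
    have h1 : IsClosed (cuspidalKernel q : Set E.arith) := by
      unfold cuspidalKernel
      exact (isClosed_singleton.preimage q.arith.continuous).inter E.isClosed_geom
    exact h1.preimage continuous_subtype_val
  obtain ⟨s₀, hs₀, hsec⟩ :=
    Literature.NumberTheory.GaloisRepresentations.exists_continuous_section_of_isClosed
      (geomKer q) hclosed
  let eH := geomQuotHomeo q hq
  let t₀ : C(F.geom, E.geom) := ⟨fun d => s₀ (eH.symm d), hs₀.comp eH.symm.continuous⟩
  have ht₀ : ∀ d, geomRestr q (t₀ d) = d := fun d => by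
    change geomRestr q (s₀ (eH.symm d)) = d
    rw [← geomQuotLift_mk, hsec, ← geomQuotHomeo_apply q hq, Homeomorph.apply_symm_apply]
  -- `θ = q|_Δ : Δ_{U_x} → Δ_X` as a continuous homomorphism
  let θ : E.geom →ₜ* F.geom := { toMonoidHom := geomRestr q, continuous_toFun := continuous_geomRestr q }
  have hθ : ∀ n : E.geom, θ n = geomRestr q n := fun _ => rfl
  -- `πΔ : Δ_{U_x} → Δ^{c-cn}_{U_x}` and the section `s₁ := πΔ ∘ t₀`
  let πΔ : E.geom → DeltaCcn q := fun δ =>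
    ⟨QuotientGroup.mk (δ : E.arith), Subgroup.mem_map.mpr ⟨δ, δ.2, rfl⟩⟩
  have hπΔc : Continuous πΔ :=
    Continuous.subtype_mk (QuotientGroup.continuous_mk.comp continuous_subtype_val) _
  let s₁ : CcnSection q :=
    { toFun := ⟨fun d => πΔ (t₀ d), hπΔc.comp t₀.continuous⟩
      proj_apply := fun d => by
        apply Subtype.ext
        change ccnProj q (QuotientGroup.mk ((t₀ d : E.geom) : E.arith)) = (d : F.arith)
        rw [ccnProj_mk]
        exact congrArg Subtype.val (ht₀ d) }
  -- WLOG the section is `s₁`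
  rw [ccnTransgression_eq q Λ s s₁]
  intro ξ
  obtain ⟨z, rfl⟩ :=
    ContinuousCohomology.homologyπ_two_surjective.{0, u, u} (ContinuousCohomology.trivCoeff F.geom Λ) ξ
  -- the cochain `F` of `z` and its cocycle identities
  set Fz := ((homogeneousCochains (ContinuousCohomology.trivCoeff F.geom Λ)).iCycles 2).hom z with hFz
  have hF0 : ((homogeneousCochains (ContinuousCohomology.trivCoeff F.geom Λ)).d 2 3).hom Fz = 0 := by
    have h := congrArg (fun ψ => ψ.hom z)
      ((homogeneousCochains (ContinuousCohomology.trivCoeff F.geom Λ)).iCycles_d 2 3)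
    simp only [TopModuleCat.hom_comp, ContinuousLinearMap.coe_comp, Function.comp_apply] at h
    exact h
  set c₀ : Λ := Fz.1 1 1 1 with hc₀
  have hF11 : ∀ b : F.geom, Fz.1 1 1 b = c₀ := fun b =>
    ContinuousCohomology.twoCocycle_one_one (Λ := Λ) Fz hF0 b
  have hF1bb : ∀ b : F.geom, Fz.1 1 b b = c₀ := fun b =>
    ContinuousCohomology.twoCocycle_one_diag (Λ := Λ) Fz hF0 b
  -- (2) the bounding function `g` on `Δ_{U_x}` (from `H²(Δ_{U_x}, Λ) = 0`)
  obtain ⟨g, hg⟩ := ContinuousCohomology.exists_oneCochain_of_pullback_eq_zero θ hH2 z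
  -- hg : g (y * e) = g y + g e - Fz.1 1 (θ y) (θ y * θ e)
  have hg1 : g 1 = c₀ := by
    have h := hg 1 1
    rw [mul_one, map_one θ, mul_one, hF11] at h
    -- `g 1 = g 1 + g 1 - c₀`
    rw [eq_sub_iff_add_eq] at h
    exact (add_left_cancel h).symm
  have hgN : ∀ n e : E.geom, θ n = 1 → g (n * e) = g n + g e - c₀ := by
    intro n e hn
    rw [hg, hn, one_mul, hF11]
  have hgN' : ∀ e n : E.geom, θ n = 1 → g (e * n) = g e + g n - c₀ := by
    intro e n hn
    rw [hg, hn, mul_one, hF1bb]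
  have hinv : ∀ δ n : E.geom, θ n = 1 → g (δ * n * δ⁻¹) = g n := by
    intro δ n hn
    have hn' : θ (δ * n * δ⁻¹) = 1 := by rw [map_mul, map_mul, hn, mul_one, map_inv, mul_inv_cancel]
    have h1 := hgN' δ n hn
    have h2 := hgN (δ * n * δ⁻¹) δ hn'
    rw [show δ * n * δ⁻¹ * δ = δ * n by rw [inv_mul_cancel_right]] at h2
    -- `g δ + g n - c₀ = g (δ n δ⁻¹) + g δ - c₀`
    have h3 : g δ + g n - c₀ = g (δ * n * δ⁻¹) + g δ - c₀ := h1.symm.trans h2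
    rw [sub_left_inj, add_comm (g (δ * n * δ⁻¹))] at h3
    exact (add_left_cancel h3).symm
  have hginv : ∀ n : E.geom, θ n = 1 → g n⁻¹ = c₀ + c₀ - g n := by
    intro n hn
    have hn' : θ n⁻¹ = 1 := by rw [map_inv, hn, inv_one]
    have h := hgN n⁻¹ n hn'
    rw [inv_mul_cancel, hg1] at h
    have h' := h.symm
    rw [sub_eq_iff_eq_add] at h'
    exact eq_sub_of_add_eq h'
  -- (3) `g - c₀` is constant on the fibres of `Δ_{U_x} ∩ N → Δ^{c-cn}_{U_x}`: it kills `[N, Δ]⁻`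
  let K₀ : Subgroup E.geom :=
    { carrier := {n | θ n = 1 ∧ g n = c₀}
      one_mem' := ⟨map_one θ, hg1⟩
      mul_mem' := fun {x y} hx hy => ⟨by rw [map_mul, hx.1, hy.1, mul_one], by
        rw [hgN x y hx.1, hx.2, hy.2, add_sub_cancel_right]⟩
      inv_mem' := fun {x} hx => ⟨by rw [map_inv, hx.1, inv_one], by
        rw [hginv x hx.1, hx.2, add_sub_cancel_right]⟩ }
  have hK₀c : IsClosed (K₀ : Set E.geom) := by
    change IsClosed {n : E.geom | θ n = 1 ∧ g n = c₀}
    exact (isClosed_singleton.preimage θ.continuous).inter (isClosed_singleton.preimage g.continuous)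
  let K : Subgroup E.arith := K₀.map E.geom.subtype
  have hKc : IsClosed (K : Set E.arith) := by
    rw [Subgroup.coe_map]
    exact (IsClosed.isClosedEmbedding_subtypeVal E.isClosed_geom).isClosedMap _ hK₀c
  have hcommK : ⁅cuspidalKernel q, E.geom⁆ ≤ K := by
    rw [Subgroup.commutator_le]
    intro m hm δ hδ
    have hmΔ : m ∈ E.geom := cuspidalKernel_le_geom q hm
    let nm : E.geom := ⟨m, hmΔ⟩
    let dδ : E.geom := ⟨δ, hδ⟩
    have hθm : θ nm = 1 := by
      apply Subtype.ext
      change q.arith m = 1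
      exact cuspidalKernel_le_ker q hm
    refine ⟨nm * dδ * nm⁻¹ * dδ⁻¹, ⟨?_, ?_⟩, rfl⟩
    · rw [map_mul, map_mul, map_mul, hθm, one_mul, map_inv, map_inv, hθm, inv_one, mul_one,
        mul_inv_cancel]
    · have hθm' : θ nm⁻¹ = 1 := by rw [map_inv, hθm, inv_one]
      rw [mul_assoc, mul_assoc, hgN nm _ hθm, ← mul_assoc, hinv dδ nm⁻¹ hθm', hginv nm hθm]
      abel
  have hmodK : cuspidallyCentralModulus q ≤ K :=
    Subgroup.topologicalClosure_minimal _ hcommK hKc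
  have hfibre : ∀ n n' : E.geom, θ n = 1 → θ n' = 1 →
      (QuotientGroup.mk (n : E.arith) : CuspidallyCentralQuotient q) = QuotientGroup.mk (n' : E.arith) →
      g n = g n' := by
    intro n n' hn hn' hnn'
    rw [QuotientGroup.eq] at hnn'
    obtain ⟨k, hk, hkval⟩ := Subgroup.mem_map.mp (hmodK hnn')
    have hk' : k = n⁻¹ * n' := Subtype.ext hkval
    have hgk : g (n⁻¹ * n') = c₀ := by rw [← hk']; exact hk.2
    have h := hgN n (n⁻¹ * n') hn
    rw [mul_inv_cancel_left, hgk, add_sub_cancel_right] at h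
    exact h.symm
  -- (4) descend `g - c₀` to `Ker(Δ^{c-cn}_{U_x} ↠ Δ_X)` through `I ⥲ Ker`
  haveI : CompactSpace I := isCompact_iff_compactSpace.mp hIc.isCompact
  have hIN : I ≤ cuspidalKernel q := hI.le_cuspidalKernel
  let ι : I ≃ ContinuousCohomology.extKer (deltaCcnProjₜ q) :=
    Equiv.ofBijective (inertiaToExtKer hIN) (inertiaToExtKer_bijective hI)
  have hιc : Continuous ι := continuous_inertiaToExtKer hIN
  have hιsymm : Continuous ι.symm := hιc.continuous_symm_of_equiv_compact_to_t2
  have hιmul : ∀ x y, ι.symm (x * y) = ι.symm x * ι.symm y := fun x y => by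
    apply ι.injective
    rw [Equiv.apply_symm_apply]
    change x * y = inertiaToExtKer hIN (ι.symm x * ι.symm y)
    rw [map_mul]
    change x * y = ι (ι.symm x) * ι (ι.symm y)
    rw [Equiv.apply_symm_apply, Equiv.apply_symm_apply]
  have hι1 : ι.symm 1 = 1 := by
    apply ι.injective
    rw [Equiv.apply_symm_apply]
    exact (map_one (inertiaToExtKer hIN)).symm
  let incl : I → E.geom := fun i => ⟨i, cuspidalKernel_le_geom q (hIN i.2)⟩
  have hinclc : Continuous incl := Continuous.subtype_mk continuous_subtype_val _
  have hθincl : ∀ i, θ (incl i) = 1 := fun i => by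
    apply Subtype.ext
    change q.arith (i : E.arith) = 1
    exact cuspidalKernel_le_ker q (hIN i.2)
  let χA : Additive (ContinuousCohomology.extKer (deltaCcnProjₜ q)) →ₜ+ Λ :=
    { toFun := fun x => g (incl (ι.symm (Additive.toMul x))) - c₀
      map_zero' := by
        change g (incl (ι.symm 1)) - c₀ = 0
        rw [hι1]
        have : incl 1 = 1 := Subtype.ext rfl
        rw [this, hg1, sub_self]
      map_add' := fun x y => by
        change g (incl (ι.symm (Additive.toMul x * Additive.toMul y))) - c₀ = _
        rw [hιmul]
        have : incl (ι.symm (Additive.toMul x) * ι.symm (Additive.toMul y)) =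
            incl (ι.symm (Additive.toMul x)) * incl (ι.symm (Additive.toMul y)) := Subtype.ext rfl
        rw [this, hgN _ _ (hθincl _)]
        abel
      continuous_toFun :=
        (g.continuous.comp (hinclc.comp (hιsymm.comp continuous_toMul))).sub continuous_const }
  have hχA : ∀ (a : ContinuousCohomology.extKer (deltaCcnProjₜ q)) (n : E.geom), θ n = 1 →
      ((a : DeltaCcn q) : CuspidallyCentralQuotient q) = QuotientGroup.mk (n : E.arith) →
      χA (Additive.ofMul a) = g n - c₀ := by
    intro a n hn han
    change g (incl (ι.symm a)) - c₀ = g n - c₀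
    have hia : ((ι (ι.symm a) : ContinuousCohomology.extKer (deltaCcnProjₜ q)) : DeltaCcn q) =
        (a : DeltaCcn q) := by rw [Equiv.apply_symm_apply]
    have hmk : (QuotientGroup.mk ((incl (ι.symm a) : E.geom) : E.arith) : CuspidallyCentralQuotient q) =
        QuotientGroup.mk (n : E.arith) := by
      rw [← han, ← hia]
      rfl
    rw [hfibre (incl (ι.symm a)) n (hθincl _) hn hmk]
  -- (5) the factor set of `s₁` lies over `c(b, b') := t₀ b · t₀ b' · t₀(b b')⁻¹ ∈ N ∩ Δ`
  have hfac : ∀ b b' : F.geom,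
      (((ContinuousCohomology.factorSet (deltaCcnProjₜ q) (ContinuousMonoidHom.id F.geom) s₁.toFun
          (fun d => s₁.proj_apply d) b b' : ContinuousCohomology.extKer (deltaCcnProjₜ q)) :
          DeltaCcn q) : CuspidallyCentralQuotient q) =
        QuotientGroup.mk (((t₀ b * t₀ b' * (t₀ (b * b'))⁻¹ : E.geom)) : E.arith) := by
    intro b b'
    rw [ContinuousCohomology.coe_factorSet]
    rfl
  have hθc : ∀ b b' : F.geom, θ (t₀ b * t₀ b' * (t₀ (b * b'))⁻¹) = 1 := by
    intro b b'
    rw [map_mul, map_mul, map_inv, hθ, hθ, hθ, ht₀, ht₀, ht₀, mul_inv_cancel]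
  have hχc : ∀ b b' : F.geom,
      χA (Additive.ofMul (ContinuousCohomology.factorSet (deltaCcnProjₜ q)
        (ContinuousMonoidHom.id F.geom) s₁.toFun (fun d => s₁.proj_apply d) b b')) =
        g (t₀ b) + g (t₀ b') - Fz.1 1 b (b * b') - g (t₀ (b * b')) := by
    intro b b'
    rw [hχA _ (t₀ b * t₀ b' * (t₀ (b * b'))⁻¹) (hθc b b') (hfac b b')]
    have h1 := hg (t₀ b) (t₀ b')
    rw [hθ, hθ, ht₀, ht₀] at h1
    have h2 := hgN (t₀ b * t₀ b' * (t₀ (b * b'))⁻¹) (t₀ (b * b')) (hθc b b')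
    rw [inv_mul_cancel_right] at h2
    have h3 := h2.symm.trans h1
    calc g (t₀ b * t₀ b' * (t₀ (b * b'))⁻¹) - c₀
        = (g (t₀ b * t₀ b' * (t₀ (b * b'))⁻¹) + g (t₀ (b * b')) - c₀) - g (t₀ (b * b')) := by abel
      _ = (g (t₀ b) + g (t₀ b') - Fz.1 1 b (b * b')) - g (t₀ (b * b')) := by rw [h3]
  -- (6) the bounding `1`-cochain `τ(x, y) := g(t₀(x⁻¹ y))` and the cochain identity
  let Hτ : C(F.geom × F.geom, Λ) :=
    ⟨fun p => g (t₀ (p.1⁻¹ * p.2)), g.continuous.comp (t₀.continuous.comp (continuous_fst.inv.mul continuous_snd))⟩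
  let τ : (homogeneousCochains (ContinuousCohomology.trivCoeff F.geom Λ)).X 1 :=
    ⟨Hτ.curry, fun x => by
      refine ContinuousMap.ext fun a => ContinuousMap.ext fun b => ?_
      change g (t₀ ((x⁻¹ * a)⁻¹ * (x⁻¹ * b))) = g (t₀ (a⁻¹ * b))
      rw [mul_inv_rev, inv_inv, mul_assoc, mul_inv_cancel_left]⟩
  have hsum : Fz = ContinuousCohomology.pushTwoCochain (deltaCcnProjₜ q) (ContinuousMonoidHom.id F.geom)
      s₁.toFun (fun d => s₁.proj_apply d) (-χA) +
      ((homogeneousCochains (ContinuousCohomology.trivCoeff F.geom Λ)).d 1 2).hom τ := by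
    apply Subtype.ext
    refine ContinuousMap.ext fun x => ContinuousMap.ext fun y => ContinuousMap.ext fun w => ?_
    change Fz.1 x y w = ContinuousCohomology.pushCochain (deltaCcnProjₜ q) (ContinuousMonoidHom.id F.geom)
      s₁.toFun (fun d => s₁.proj_apply d) (-χA) x y w +
      (((homogeneousCochains (ContinuousCohomology.trivCoeff F.geom Λ)).d 1 2).hom τ).1 x y w
    rw [ContinuousCohomology.pushCochain_apply, ContinuousCohomology.d_oneCochain_apply,
      ContinuousCohomology.twoCochain_apply_eq (Λ := Λ) Fz x y w]
    change Fz.1 1 (x⁻¹ * y) (x⁻¹ * w) = -(χA (Additive.ofMul _)) +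
      (g (t₀ (y⁻¹ * w)) - (g (t₀ (x⁻¹ * w)) - g (t₀ (x⁻¹ * y))))
    rw [hχc]
    have e1 : x⁻¹ * y * (y⁻¹ * w) = x⁻¹ * w := by rw [mul_assoc, mul_inv_cancel_left]
    rw [e1]
    abel
  -- (7) conclusion: `[z] = d_{s₁}(-χA)`
  refine ⟨-χA, ?_⟩
  have hz : z = ContinuousCohomology.cocycleMkTwo (ContinuousCohomology.trivCoeff F.geom Λ)
      (ContinuousCohomology.pushTwoCochain (deltaCcnProjₜ q) (ContinuousMonoidHom.id F.geom) s₁.toFun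
        (fun d => s₁.proj_apply d) (-χA))
      (ContinuousCohomology.d_pushTwoCochain (deltaCcnProjₜ q) (ContinuousMonoidHom.id F.geom) s₁.toFun
        (fun d => s₁.proj_apply d) (deltaCcn_central q) (-χA)) +
      ((homogeneousCochains (ContinuousCohomology.trivCoeff F.geom Λ)).toCycles 1 2).hom τ := by
    apply ContinuousCohomology.cocyclesTwo_ext (ContinuousCohomology.trivCoeff F.geom Λ)
    rw [map_add, ContinuousCohomology.iCycles_cocycleMkTwo]
    have h := congrArg (fun ψ => ψ.hom τ)
      ((homogeneousCochains (ContinuousCohomology.trivCoeff F.geom Λ)).toCycles_i 1 2)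
    simp only [TopModuleCat.hom_comp, ContinuousLinearMap.coe_comp, Function.comp_apply] at h
    rw [h, ← hsum]
  change ContinuousCohomology.transgression (deltaCcnProjₜ q) (ContinuousMonoidHom.id F.geom) s₁.toFun
    (fun d => s₁.proj_apply d) (deltaCcn_central q) (-χA) =
    ((homogeneousCochains (ContinuousCohomology.trivCoeff F.geom Λ)).homologyπ 2).hom z
  rw [ContinuousCohomology.transgression_apply]
  conv_rhs => rw [hz]
  rw [map_add]
  have h0 := congrArg (fun ψ => ψ.hom τ)
    ((homogeneousCochains (ContinuousCohomology.trivCoeff F.geom Λ)).toCycles_comp_homologyπ 1 2)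
  simp only [TopModuleCat.hom_comp, ContinuousLinearMap.coe_comp, Function.comp_apply] at h0
  rw [h0]
  change _ = _ + (0 : continuousCohomology 2 (ContinuousCohomology.trivCoeff F.geom Λ))
  rw [add_zero]

/-- The same with the hypothesis phrased through abc-iut-L4-t1's `geomH2 E Λ = H²(Δ_{U_x}, Λ)`:
`Subsingleton (geomH2 E Λ)` ("`H²(Δ_{U_x}, Λ) = 0`"). [cite: MochizukiAbsTopIII2015, Prop 1.4 (ii) p.31] -/
theorem ccnTransgression_surjective_of_subsingleton_geomH2 [T1Space Λ]
    (hq : Set.SurjOn q.arith E.geom F.geom) {I : Subgroup E.arith}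
    (hI : IsCuspidallyCentralExtension q I) (hIc : IsClosed (I : Set E.arith))
    [hH2 : Subsingleton (geomH2 E Λ)] (s : CcnSection q) :
    Function.Surjective (ccnTransgression q Λ s) :=
  ccnTransgression_surjective_of_geomH2_trivial q Λ hq hI hIc (fun _ => Subsingleton.elim _ _) s

namespace CurveModel

variable (M : CurveModel.{u})

/-- **Prop. 1.4 (ii), surjectivity half, relative to `M`, PROVED at the instance class
`H²(Δ_{U_x}, Λ) = 0`.**  For every cyclotome presentation `(U_x ⊆ X, x)` of the model with
`Δ_{U_x} ↠ Δ_X` (the surjectivity clause of Prop. 1.4 (i), `Prop_1_4_i'`) and `H²(Δ_{U_x}, Λ) = 0`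
(`Δ_{U_x}` free profinite, `U_x` affine — [AbsTopI] Lem. 4.5 (i)), the differential
`Hom_cont(Ker(Δ^{c-cn}_{U_x} ↠ Δ_X), Λ) → H²(Δ_X, Λ)` is SURJECTIVE for every section and every `T₁`
coefficient group `Λ`. [cite: MochizukiAbsTopIII2015, Prop 1.4 (ii) p.31] -/
theorem ccnTransgression_surjective_of_subsingleton_geomH2 {Ux X : M.Curve}
    (h : M.IsCofiniteOpen Ux X) (x : (M.cusps Ux).Cusp) (hp : M.IsCyclotomePresentation h x)
    (hq : Set.SurjOn (M.res h).arith (M.ext Ux).geom (M.ext X).geom)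
    (Λ : Type u) [AddCommGroup Λ] [TopologicalSpace Λ] [IsTopologicalAddGroup Λ] [T1Space Λ]
    [Subsingleton (geomH2 (M.ext Ux) Λ)] (s : CcnSection (M.res h)) :
    Function.Surjective (ccnTransgression (M.res h) Λ s) :=
  AbsTopIII.ccnTransgression_surjective_of_subsingleton_geomH2 (M.res h) Λ hq hp.isCuspidallyCentral
    ((M.cusps Ux).isClosed_Icusp x) s

/-- **Prop. 1.4 (ii) — BIJECTIVITY of the differential, relative to `M`, at the printed instance
class.**  For every cyclotome presentation `(U_x ⊆ X, x)` of the model with `Δ_{U_x} ↠ Δ_X`,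
`I_x ≤ [Δ_{U_x}, Δ_{U_x}]⁻` (one puncture: `Δ_{U_x}^{ab} = Δ_X^{ab}`) and `H²(Δ_{U_x}, Λ) = 0` (`Δ_{U_x}`
free profinite), the differential of Prop. 1.4 (ii) is BIJECTIVE for every section and every `T₁`
coefficient group — the conclusion of the named fact `Prop_1_4_ii_transgression` at this presentation
(take `Λ = ZHatCoeff`), DISCHARGED modulo these structural inputs on the model.
[cite: MochizukiAbsTopIII2015, Prop 1.4 (ii) p.31] -/
theorem ccnTransgression_bijective_of_inertia_le_commutator_of_subsingleton_geomH2 {Ux X : M.Curve}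
    (h : M.IsCofiniteOpen Ux X) (x : (M.cusps Ux).Cusp) (hp : M.IsCyclotomePresentation h x)
    (hq : Set.SurjOn (M.res h).arith (M.ext Ux).geom (M.ext X).geom)
    (hI : (M.cusps Ux).Icusp x ≤ (⁅(M.ext Ux).geom, (M.ext Ux).geom⁆).topologicalClosure)
    (Λ : Type u) [AddCommGroup Λ] [TopologicalSpace Λ] [IsTopologicalAddGroup Λ] [T1Space Λ]
    [Subsingleton (geomH2 (M.ext Ux) Λ)] (s : CcnSection (M.res h)) :
    Function.Bijective (ccnTransgression (M.res h) Λ s) :=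
  ⟨M.ccnTransgression_injective_of_inertia_le_commutator h x hp hI Λ s,
    M.ccnTransgression_surjective_of_subsingleton_geomH2 h x hp hq Λ s⟩

/-- **`Prop_1_4_ii_transgression M` PROVED at the instance class**: a model ALL of whose cyclotome
presentations have `Δ_{U_x} ↠ Δ_X`, `I_x ≤ [Δ_{U_x}, Δ_{U_x}]⁻` and `H²(Δ_{U_x}, Ẑ) = 0` satisfies the
named fact F-0338 verbatim. [cite: MochizukiAbsTopIII2015, Prop 1.4 (ii) p.31] -/
theorem prop_1_4_ii_transgression_of_instanceClass
    (hq : ∀ (Ux X : M.Curve) (h : M.IsCofiniteOpen Ux X) (x : (M.cusps Ux).Cusp),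
      M.IsCyclotomePresentation h x → Set.SurjOn (M.res h).arith (M.ext Ux).geom (M.ext X).geom)
    (hI : ∀ (Ux X : M.Curve) (h : M.IsCofiniteOpen Ux X) (x : (M.cusps Ux).Cusp),
      M.IsCyclotomePresentation h x →
        (M.cusps Ux).Icusp x ≤ (⁅(M.ext Ux).geom, (M.ext Ux).geom⁆).topologicalClosure)
    (hH2 : ∀ (Ux X : M.Curve) (h : M.IsCofiniteOpen Ux X) (x : (M.cusps Ux).Cusp),
      M.IsCyclotomePresentation h x → Subsingleton (geomH2 (M.ext Ux) ZHatCoeff.{u})) :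
    M.Prop_1_4_ii_transgression := by
  intro Ux X h x hp s
  haveI := hH2 Ux X h x hp
  exact M.ccnTransgression_bijective_of_inertia_le_commutator_of_subsingleton_geomH2 h x hp
    (hq Ux X h x hp) (hI Ux X h x hp) ZHatCoeff.{u} s

end CurveModel

end Literature.AnabelianGeometry.AbsoluteAnabelian.AbsTopIII

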